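import Mathlib
import Literature.Analysis.FluidPDE.SpaceTimeCalculus

/-!
# Route PhotonSphereChannels · BlindnessInsidePhotonSphere — pointwise calculus of `C²`
# space–time fields on `ℝ × ℝ` and of the energy density `ψ_t² + ψ_x² + V ψ²`

Support file (pure analysis, everything proved) for item stmt-FinalStateConjecture-10049.
For `φ : ℝ → ℝ → ℝ` with `uncurry φ ∈ C²`, write `φ_t = D(uncurry φ)(·)(1,0)`,
`φ_x = D(uncurry φ)(·)(0,1)` and the four second partials as derivatives of these `C¹` fields.
This file records: the time-line/space-line derivatives of `φ`, `φ_t`, `φ_x`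
(`hasDerivAt_time`, `hasDerivAt_space`); Schwarz `φ_xt = φ_tx` (`mixed_partials_eq`, Mathlib's
`ContDiffAt.isSymmSndFDerivAt`); the dictionary with the route statement's `deriv` /
`iteratedDeriv 2` (`deriv_time_eq`, `deriv_space_eq`, `iteratedDeriv_time_eq`,
`iteratedDeriv_space_eq`); and the pointwise energy identity
`∂_t e = 2 φ_t (φ_tt − φ_xx + Vφ) + 2 ∂_x(φ_t φ_x)` for `e = φ_t² + φ_x² + V φ²`
(`hasDerivAt_energyDensity_time`, `hasDerivAt_flux_space`, `energyDensity_time_identity`)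
(Evans, *PDE*, §2.4.3; Alinhac, *Hyperbolic PDE*, Ch. 6). No definitions are introduced.
-/

noncomputable section

open Set Filter Topology Function

namespace Summit.FinalStateConjecture.FinalStateConjecture.Theorems.Blindness

section Lines

variable {φ : ℝ → ℝ → ℝ}

/-- Time lines of a `C¹` field: `∂_t φ(t,x) = D(uncurry φ)(t,x)(1,0)`. -/
theorem hasDerivAt_time (hφ : ContDiff ℝ 1 (uncurry φ)) (t x : ℝ) :
    HasDerivAt (fun s => φ s x) (fderiv ℝ (uncurry φ) (t, x) (1, 0)) t :=
  Literature.Analysis.FluidPDE.hasDerivAt_timeLine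
    ((hφ.differentiable one_ne_zero) (t, x)).hasFDerivAt

/-- Space lines of a `C¹` field: `∂_x φ(t,x) = D(uncurry φ)(t,x)(0,1)`. -/
theorem hasDerivAt_space (hφ : ContDiff ℝ 1 (uncurry φ)) (t x : ℝ) :
    HasDerivAt (φ t) (fderiv ℝ (uncurry φ) (t, x) (0, 1)) x := by
  have h := (Literature.Analysis.FluidPDE.hasFDerivAt_slice
    ((hφ.differentiable one_ne_zero) (t, x)).hasFDerivAt).hasDerivAt
  refine h.congr_deriv ?_
  simp

/-- The first partials of a `C^{n+1}` field are `Cⁿ` fields (`n = 1` here). -/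
theorem contDiff_one_fderiv_apply (hφ : ContDiff ℝ 2 (uncurry φ)) (v : ℝ × ℝ) :
    ContDiff ℝ 1 (uncurry fun t x => fderiv ℝ (uncurry φ) (t, x) v) := by
  have h : ContDiff ℝ 1 (fderiv ℝ (uncurry φ)) := hφ.fderiv_right (m := 1) (by norm_num)
  exact h.clm_apply contDiff_const

/-- Continuity of the first partials of a `C²` field. -/
theorem continuous_fderiv_apply (hφ : ContDiff ℝ 2 (uncurry φ)) (v : ℝ × ℝ) :
    Continuous (uncurry fun t x => fderiv ℝ (uncurry φ) (t, x) v) :=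
  (contDiff_one_fderiv_apply hφ v).continuous

/-- Second partials as values of the second derivative: `D(D(uncurry φ)(·) v)(p) w = D²(uncurry φ)(p) w v`. -/
theorem fderiv_fderiv_apply (hφ : ContDiff ℝ 2 (uncurry φ)) (p v w : ℝ × ℝ) :
    fderiv ℝ (uncurry fun t x => fderiv ℝ (uncurry φ) (t, x) v) p w
      = fderiv ℝ (fderiv ℝ (uncurry φ)) p w v := by
  have hd2 : HasFDerivAt (fderiv ℝ (uncurry φ)) (fderiv ℝ (fderiv ℝ (uncurry φ)) p) p :=
    (((hφ.fderiv_right (m := 1) (by norm_num)).differentiable one_ne_zero) p).hasFDerivAt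
  have h := (ContinuousLinearMap.apply ℝ ℝ v).hasFDerivAt.comp p hd2
  have h' : HasFDerivAt (uncurry fun t x => fderiv ℝ (uncurry φ) (t, x) v)
      ((ContinuousLinearMap.apply ℝ ℝ v).comp (fderiv ℝ (fderiv ℝ (uncurry φ)) p)) p :=
    h.congr_of_eventuallyEq (Eventually.of_forall fun q => rfl)
  rw [h'.fderiv]
  rfl

/-- **Schwarz**: `φ_xt = φ_tx`, i.e. the time derivative of `φ_x` is the space derivative of
`φ_t`. -/
theorem mixed_partials_eq (hφ : ContDiff ℝ 2 (uncurry φ)) (p : ℝ × ℝ) :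
    fderiv ℝ (uncurry fun t x => fderiv ℝ (uncurry φ) (t, x) (0, 1)) p (1, 0)
      = fderiv ℝ (uncurry fun t x => fderiv ℝ (uncurry φ) (t, x) (1, 0)) p (0, 1) := by
  rw [fderiv_fderiv_apply hφ, fderiv_fderiv_apply hφ]
  have hs : IsSymmSndFDerivAt ℝ (uncurry φ) p :=
    (hφ.contDiffAt (x := p)).isSymmSndFDerivAt (by simp)
  exact hs (1, 0) (0, 1)

/-- Dictionary: `deriv` along time lines. -/
theorem deriv_time_eq (hφ : ContDiff ℝ 1 (uncurry φ)) (t x : ℝ) :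
    deriv (fun s => φ s x) t = fderiv ℝ (uncurry φ) (t, x) (1, 0) :=
  (hasDerivAt_time hφ t x).deriv

/-- Dictionary: `deriv` along space lines. -/
theorem deriv_space_eq (hφ : ContDiff ℝ 1 (uncurry φ)) (t x : ℝ) :
    deriv (φ t) x = fderiv ℝ (uncurry φ) (t, x) (0, 1) :=
  (hasDerivAt_space hφ t x).deriv

/-- Dictionary: `iteratedDeriv 2` along time lines is the second time partial `φ_tt`. -/
theorem iteratedDeriv_time_eq (hφ : ContDiff ℝ 2 (uncurry φ)) (t x : ℝ) :
    iteratedDeriv 2 (fun s => φ s x) t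
      = fderiv ℝ (uncurry fun s y => fderiv ℝ (uncurry φ) (s, y) (1, 0)) (t, x) (1, 0) := by
  have h1 : deriv (fun s => φ s x) = fun s => fderiv ℝ (uncurry φ) (s, x) (1, 0) :=
    funext fun s => deriv_time_eq (hφ.of_le (by norm_num)) s x
  rw [iteratedDeriv_succ, iteratedDeriv_one, h1]
  exact (hasDerivAt_time (contDiff_one_fderiv_apply hφ (1, 0)) t x).deriv

/-- Dictionary: `iteratedDeriv 2` along space lines is the second space partial `φ_xx`. -/
theorem iteratedDeriv_space_eq (hφ : ContDiff ℝ 2 (uncurry φ)) (t x : ℝ) :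
    iteratedDeriv 2 (φ t) x
      = fderiv ℝ (uncurry fun s y => fderiv ℝ (uncurry φ) (s, y) (0, 1)) (t, x) (0, 1) := by
  have h1 : deriv (φ t) = fun y => fderiv ℝ (uncurry φ) (t, y) (0, 1) :=
    funext fun y => deriv_space_eq (hφ.of_le (by norm_num)) t y
  rw [iteratedDeriv_succ, iteratedDeriv_one, h1]
  exact (hasDerivAt_space (contDiff_one_fderiv_apply hφ (0, 1)) t x).deriv

end Lines

/-! ### The energy density and the flux -/

section Energy

variable {φ : ℝ → ℝ → ℝ} {V : ℝ → ℝ}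

/-- Time derivative of the energy density `e = φ_t² + φ_x² + V φ²` along a time line:
`∂_t e = 2 φ_t φ_tt + 2 φ_x φ_xt + 2 V φ φ_t`. -/
theorem hasDerivAt_energyDensity_time (hφ : ContDiff ℝ 2 (uncurry φ)) (t x : ℝ) :
    HasDerivAt (fun s => fderiv ℝ (uncurry φ) (s, x) (1, 0) ^ 2
        + fderiv ℝ (uncurry φ) (s, x) (0, 1) ^ 2 + V x * φ s x ^ 2)
      (2 * fderiv ℝ (uncurry φ) (t, x) (1, 0)
          * fderiv ℝ (uncurry fun s y => fderiv ℝ (uncurry φ) (s, y) (1, 0)) (t, x) (1, 0)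
        + 2 * fderiv ℝ (uncurry φ) (t, x) (0, 1)
          * fderiv ℝ (uncurry fun s y => fderiv ℝ (uncurry φ) (s, y) (0, 1)) (t, x) (1, 0)
        + V x * (2 * φ t x * fderiv ℝ (uncurry φ) (t, x) (1, 0))) t := by
  have h1 := hasDerivAt_time (contDiff_one_fderiv_apply hφ (1, 0)) t x
  have h2 := hasDerivAt_time (contDiff_one_fderiv_apply hφ (0, 1)) t x
  have h3 := hasDerivAt_time (hφ.of_le (by norm_num)) t x
  have h := ((h1.pow 2).add (h2.pow 2)).add ((h3.pow 2).const_mul (V x))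
  refine (h.congr_of_eventuallyEq (Eventually.of_forall fun s => rfl)).congr_deriv ?_
  simp only [Nat.cast_ofNat]
  ring

/-- Space derivative of the flux `φ_t φ_x` along a space line:
`∂_x(φ_t φ_x) = φ_tx φ_x + φ_t φ_xx`. -/
theorem hasDerivAt_flux_space (hφ : ContDiff ℝ 2 (uncurry φ)) (t x : ℝ) :
    HasDerivAt (fun y => fderiv ℝ (uncurry φ) (t, y) (1, 0) * fderiv ℝ (uncurry φ) (t, y) (0, 1))
      (fderiv ℝ (uncurry fun s y => fderiv ℝ (uncurry φ) (s, y) (1, 0)) (t, x) (0, 1)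
          * fderiv ℝ (uncurry φ) (t, x) (0, 1)
        + fderiv ℝ (uncurry φ) (t, x) (1, 0)
          * fderiv ℝ (uncurry fun s y => fderiv ℝ (uncurry φ) (s, y) (0, 1)) (t, x) (0, 1)) x := by
  have h1 := hasDerivAt_space (contDiff_one_fderiv_apply hφ (1, 0)) t x
  have h2 := hasDerivAt_space (contDiff_one_fderiv_apply hφ (0, 1)) t x
  exact (h1.mul h2).congr_of_eventuallyEq (Eventually.of_forall fun s => rfl)

/-- **The pointwise energy identity** `∂_t e = 2 φ_t (φ_tt − φ_xx + Vφ) + 2 ∂_x(φ_t φ_x)`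
(Schwarz `φ_xt = φ_tx`). Stated as an equality between the two derivative expressions of
`hasDerivAt_energyDensity_time` and `hasDerivAt_flux_space`. -/
theorem energyDensity_time_identity (hφ : ContDiff ℝ 2 (uncurry φ)) (t x : ℝ) :
    2 * fderiv ℝ (uncurry φ) (t, x) (1, 0)
          * fderiv ℝ (uncurry fun s y => fderiv ℝ (uncurry φ) (s, y) (1, 0)) (t, x) (1, 0)
        + 2 * fderiv ℝ (uncurry φ) (t, x) (0, 1)
          * fderiv ℝ (uncurry fun s y => fderiv ℝ (uncurry φ) (s, y) (0, 1)) (t, x) (1, 0)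
        + V x * (2 * φ t x * fderiv ℝ (uncurry φ) (t, x) (1, 0))
      = 2 * fderiv ℝ (uncurry φ) (t, x) (1, 0)
          * (fderiv ℝ (uncurry fun s y => fderiv ℝ (uncurry φ) (s, y) (1, 0)) (t, x) (1, 0)
            - fderiv ℝ (uncurry fun s y => fderiv ℝ (uncurry φ) (s, y) (0, 1)) (t, x) (0, 1)
            + V x * φ t x)
        + 2 * (fderiv ℝ (uncurry fun s y => fderiv ℝ (uncurry φ) (s, y) (1, 0)) (t, x) (0, 1)
            * fderiv ℝ (uncurry φ) (t, x) (0, 1)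
          + fderiv ℝ (uncurry φ) (t, x) (1, 0)
            * fderiv ℝ (uncurry fun s y => fderiv ℝ (uncurry φ) (s, y) (0, 1)) (t, x) (0, 1)) := by
  rw [mixed_partials_eq hφ (t, x)]
  ring

/-- The residual `φ_tt − φ_xx + Vφ` in the route statement's `iteratedDeriv` form equals its
`fderiv` form. -/
theorem residual_eq (hφ : ContDiff ℝ 2 (uncurry φ)) (t x : ℝ) :
    iteratedDeriv 2 (fun s => φ s x) t - iteratedDeriv 2 (φ t) x + V x * φ t x
      = fderiv ℝ (uncurry fun s y => fderiv ℝ (uncurry φ) (s, y) (1, 0)) (t, x) (1, 0)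
        - fderiv ℝ (uncurry fun s y => fderiv ℝ (uncurry φ) (s, y) (0, 1)) (t, x) (0, 1)
        + V x * φ t x := by
  rw [iteratedDeriv_time_eq hφ, iteratedDeriv_space_eq hφ]

/-- The energy density in the route statement's `deriv` form equals its `fderiv` form. -/
theorem energyDensity_eq (hφ : ContDiff ℝ 2 (uncurry φ)) (t x : ℝ) :
    deriv (fun s => φ s x) t ^ 2 + deriv (φ t) x ^ 2 + V x * φ t x ^ 2
      = fderiv ℝ (uncurry φ) (t, x) (1, 0) ^ 2 + fderiv ℝ (uncurry φ) (t, x) (0, 1) ^ 2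
        + V x * φ t x ^ 2 := by
  rw [deriv_time_eq (hφ.of_le (by norm_num)), deriv_space_eq (hφ.of_le (by norm_num))]

/-- `e + 2 φ_t φ_x = (φ_t + φ_x)² + V φ² ≥ 0` for `V ≥ 0`: the outgoing null flux is signed. -/
theorem energyDensity_add_two_flux_nonneg {v : ℝ} (hv : 0 ≤ v) (a b u : ℝ) :
    0 ≤ a ^ 2 + b ^ 2 + v * u ^ 2 + 2 * (a * b) := by
  nlinarith [sq_nonneg (a + b), mul_nonneg hv (sq_nonneg u)]

end Energy

/-! ### Vanishing outside the domain of influence -/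

section Support

variable {φ : ℝ → ℝ → ℝ} {α β : ℝ}

/-- The exterior of the domain of influence of `[α, β]` is open. -/
theorem isOpen_exterior (α β : ℝ) :
    IsOpen {p : ℝ × ℝ | p.2 < α - |p.1| ∨ β + |p.1| < p.2} := by
  refine IsOpen.union ?_ ?_
  · exact isOpen_lt continuous_snd (continuous_const.sub (continuous_abs.comp continuous_fst))
  · exact isOpen_lt (continuous_const.add (continuous_abs.comp continuous_fst)) continuous_snd

/-- A field vanishing outside the domain of influence has vanishing first partials there. -/
theorem fderiv_eq_zero_of_exterior (h0 : ∀ t x, (x < α - |t| ∨ β + |t| < x) → φ t x = 0)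
    {t x : ℝ} (hx : x < α - |t| ∨ β + |t| < x) (v : ℝ × ℝ) :
    fderiv ℝ (uncurry φ) (t, x) v = 0 := by
  have hev : uncurry φ =ᶠ[𝓝 (t, x)] fun _ => (0 : ℝ) := by
    filter_upwards [(isOpen_exterior α β).mem_nhds (show (t, x) ∈ _ from hx)] with p hp
    exact h0 p.1 p.2 hp
  rw [hev.fderiv_eq]
  simp

/-- The first partial fields of a field vanishing outside the domain of influence vanish there
(as curried fields, ready for iteration). -/
theorem fderiv_field_eq_zero_of_exterior
    (h0 : ∀ t x, (x < α - |t| ∨ β + |t| < x) → φ t x = 0) (v : ℝ × ℝ) :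
    ∀ t x, (x < α - |t| ∨ β + |t| < x) → (fun s y => fderiv ℝ (uncurry φ) (s, y) v) t x = 0 :=
  fun _ _ hx => fderiv_eq_zero_of_exterior h0 hx v

end Support

end Summit.FinalStateConjecture.FinalStateConjecture.Theorems.Blindness

end
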